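import Summits.QuantumFields.BalabanUV.Beta.EriceRemainderEnclosureHistoryAutonomyComparisonAgeCompositionYoungPairMoment

/-!
# EriceRemainderEnclosureHistoryAutonomyComparisonAgeCompositionYoungPairMomentRefined — (E94d) route (N), first order: THE REFINED WINDOW LETTER OF THE
# YOUNG PAIR, and the rows `k₂ = 9, 10` of the census three ages.  (E94b)'s window letter reads every young target of `[m, m+k₂)` at the level `h_{m+k₂}`
# and the middle's own window through the tangent bound `ζ²(3k₂+1) ≤ 8k₂`; here the first `U` young targets are read under the RAY from the pin
# (`h_{m+2+u} ≥ s_u h_{m+1}`, `s_u²(u+2) ≤ 1`) and the middle's window term by term (`h_{m+k₂+1+q} ≥ r_q h_{m+k₂}`, `r_q²(k₂+1+q) ≤ k₂`):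
# `2(Σ_{u<U} s_u)σ·x + 2(k₂−1−U+ρ)·x + (2Σ_q r_q∕k₂)σ³·y ≤ σ³` for EVERY `U ≤ k₂−1`.  With the own-window cap `so = 0.6142` and the moment letter of (E94b),
# rational certificates (2 boxes for `k₂ = 9`, 4 for `k₂ = 10`) close the rows `9` and `10` from `k₃ ≥ 57`, hence — with (E90c) and (E94c) — **the census
# three ages `{1, k₂, k₃}` hold the END at EVERY `k₃` for every `2 ≤ k₂ ≤ 10`** (the same letters give `k₃ ≥ 62, 68, 73, 79, 84, 90` for `k₂ = 11 … 16`)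

Cell `pub-balaban`, β-function sub-cell, BINDER row D4 «RemainderConst leaves for Bałaban's split» (`HOME/BINDER-OWNERS.md`; owner lineage `b2b-balaban-beta-an4`;
this file by co-owner #2 lineage `b2b-balaban-beta-d4-p2`, generation 84), β-FLOW TEAM duty (1), FREEZE (0) honoured (def-free; nothing restated).

HONEST FRAMING (page 1, verbatim and binding).  *"Discharging BetaPertH makes Bałaban's UV stability UNCONDITIONAL — a real constructive-QFT result; it is
NOT the continuum limit and NOT the Clay problem."*  THIS FILE DISCHARGES NOTHING OF THE KIND.  Elementary real algebra ∕ real analysis about ABSTRACT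
functionals on a box ]0,γ]^ℕ with displayed floors, profiles and signs, and the FIRST-ORDER renewal objects of route (N) built from them — hypotheses of a
census, not facts; the form, signs, ages and moments of Bałaban's (1.22) limit functional are NOT PRINTED ([I] p. 298; GAPS G-t4-U2-1∕-2) and NOT asserted.
Row D4 class UNCHANGED (critical-path width 0; instance 0∕1; D4 DISCHARGE NO DATE).  HONEST DEPENDENCY: continuum YM on T⁴ ⇐ BetaPertH ∧ nine spine
estimates (0/9 proved); BetaPertH ⇐ (D1) ∧ (D4) ∧ CAP+tail; G-an2-4 gates asym, D1 and NE2/3/4.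

THE POINT (README `HOME/b2b-balaban-beta-d4-p2/g84/README.md` §2; certificates by `g84/numerics/rows_cert.py`, exact rational arithmetic).  Uses (E94b)
`young_pair_letters`∕`load_le_of_sq`, (E92c) `residual_step_moment`∕`row_moment_le`, (E92a) `renewal_bounds_of_step`, (E91a) `old_read_variation`, (E90b)
`mul_sq_le_from_pin`, (E88d) `invSq_sub_ge_all_reads`, (E92b) `two_terms_le_reads`, (E82a) `kernel_entry_le`∕`row_mass_le`, (E80b) `aggregate_eq_sum`,
BY NAME.  NOT CLAIMED: `k₂ ≥ 11` below the thresholds above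
(`57 ≤ k₃ ≤ 61 … 89`: the total-load certificate of README §3); anything printed — NOT B12 Thm 2, NOT BetaPertH, NOT continuum, NOT Clay.

WHAT IS PROVED ([folklore]; 0 `def`, 0 sorry).  §1 `ray_le` (`r²(j+n) ≤ j ⟹ r·h_{m+j} ≤ h_{m+j+n}`), **`window_letter_refined`**.  §2
**`flow_nonneg_three_ages_young_pair_moment_refined`** (parametric: `ρ, s, r, so, κ` and the displayed inequality under all `U`).  The certificates for
`k₂ = 9, 10` and the rows are in the sequel (E94e) `…YoungPairMomentRefinedRows`.
-/
noncomputable section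
open Finset

namespace Summit.QuantumFields.BalabanUV.Beta.EriceRemainderEnclosureHistoryAutonomyComparisonAgeCompositionYoungPairMomentRefined

open Literature.MathematicalPhysics.QuantumFieldTheory.Balaban1983to89
open Literature.MathematicalPhysics.QuantumFieldTheory.Balaban1983to89.T4BetaStationary
open Literature.MathematicalPhysics.QuantumFieldTheory.Balaban1983to89.T4BetaFlowWellPosed
open Summit.QuantumFields.BalabanUV.Beta.EriceRemainderEnclosureHistoryAutonomyOrder (strictAnti_of_memFlow)
open Summit.QuantumFields.BalabanUV.Beta.EriceRemainderEnclosureHistoryAutonomyComparisonAgeCompositionWindowShares (mul_sq_le_from_pin)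
open Summit.QuantumFields.BalabanUV.Beta.EriceRemainderEnclosureHistoryAutonomyComparisonAgeCompositionThreeAgesFlowReads (invSq_sub_ge_all_reads)
open Summit.QuantumFields.BalabanUV.Beta.EriceRemainderEnclosureHistoryAutonomyComparisonAgeCompositionPairShares (two_terms_le_reads)
open Summit.QuantumFields.BalabanUV.Beta.EriceRemainderEnclosureHistoryAutonomyComparisonAgeCompositionYoungestTailSumFlow
  (kernel_entry_le row_mass_le)
open Summit.QuantumFields.BalabanUV.Beta.EriceRemainderEnclosureHistoryAutonomyComparisonAgeCompositionChainWiring (aggregate_eq_sum)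
open Summit.QuantumFields.BalabanUV.Beta.EriceRemainderEnclosureHistoryAutonomyComparisonAgeCompositionTwoAgesOldRead (old_read_variation)
open Summit.QuantumFields.BalabanUV.Beta.EriceRemainderEnclosureHistoryAutonomyComparisonAgeCompositionNestedReads (renewal_bounds_of_step)
open Summit.QuantumFields.BalabanUV.Beta.EriceRemainderEnclosureHistoryAutonomyComparisonAgeCompositionNestedMoments
  (residual_step_moment row_moment_le)
open Summit.QuantumFields.BalabanUV.Beta.EriceRemainderEnclosureHistoryAutonomyComparisonAgeCompositionYoungPairMoment
  (load_le_of_sq young_pair_letters)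

variable {B : (ℕ → ℝ) → ℝ} {γ b gIR : ℝ} {L : ℕ → ℝ} {K : ℕ} {h g : ℕ → ℝ}

/-! ## §1 The refined window letter -/

/-- THE RAY, one term: `r²·(j+n) ≤ j` ⟹ `r·h_{m+j} ≤ h_{m+j+n}` ((E90b) `mul_sq_le_from_pin`: `j·h_{m+j}² ≤ (j+n)·h_{m+j+n}²`). [folklore] -/
theorem ray_le (hmono : ∀ u v : ℕ → ℝ, SeqBox γ u → SeqBox γ v → (∀ j, u j ≤ v j) → B u ≤ B v) (hb : 0 < b)
    (hlo : ∀ u, SeqBox γ u → b ≤ B u) (hh : SeqBox γ h) (hf : MemFlow B gIR h) (m : ℕ) {j : ℕ} (hj : 1 ≤ j) (n : ℕ) {r : ℝ}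
    (hr : r ^ 2 * ((j : ℝ) + n) ≤ j) : r * h (m + j) ≤ h (m + j + n) := by
  have hpos : ∀ n, 0 < h n := fun n => (hh n).1
  have hray := mul_sq_le_from_pin hmono hb hlo hh hf m j n
  have hjn : (0 : ℝ) < (j : ℝ) + n := by
    have : (1 : ℝ) ≤ j := by exact_mod_cast hj
    positivity
  have hsq : (r * h (m + j)) ^ 2 ≤ h (m + j + n) ^ 2 := by
    rw [mul_pow]
    have h1 : r ^ 2 * ((j : ℝ) + n) * h (m + j) ^ 2 ≤ (j : ℝ) * h (m + j) ^ 2 := mul_le_mul_of_nonneg_right hr (sq_nonneg _)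
    have h2 : ((j : ℝ) + n) * (r ^ 2 * h (m + j) ^ 2) ≤ ((j : ℝ) + n) * h (m + j + n) ^ 2 := by nlinarith [h1, hray]
    exact le_of_mul_le_mul_left h2 hjn
  exact le_of_pow_le_pow_left₀ two_ne_zero (hpos _).le hsq

/-- **THE REFINED WINDOW LETTER OF THE YOUNG PAIR.**  Ages `1 < j < K` (any others allowed, `L ≥ 0`); `σ = h_{m+1}∕h_{m+j}`, `x = L_1h_{m+1}³∕2`,
`y = j·L_jh_{m+j}³∕2`; `ρ²(j+1) ≤ j`; young ray constants `s_u²(u+2) ≤ 1` (`u+2 ≤ j`), middle ray constants `r_q²(j+1+q) ≤ j` (`q < j`).  For every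
`U ≤ j−1`: `2(Σ_{u<U} s_u)σ·x + 2(j−1−U+ρ)·x + (2Σ_{q<j} r_q∕j)σ³·y ≤ σ³` — the rise over `[m, m+j)` dominates the young reads (the first `U` under the
ray from the pin, the next `j−1−U` at the level `h_{m+j}`, the last at `ρh_{m+j}`) and the middle's own window term by term. [folklore] -/
theorem window_letter_refined (hmono : ∀ u v : ℕ → ℝ, SeqBox γ u → SeqBox γ v → (∀ j, u j ≤ v j) → B u ≤ B v)
    (hL : ∀ k, 0 ≤ L k) (hb : 0 < b) (hlo : ∀ u, SeqBox γ u → b ≤ B u) (hdom : ∀ u, SeqBox γ u → ∑ k ∈ range K, L k * u k ≤ B u)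
    (hh : SeqBox γ h) (hf : MemFlow B gIR h) {j : ℕ} (hj : 2 ≤ j) (hjK : j < K) {ρ : ℝ} {s r : ℕ → ℝ} (hρ : ρ ^ 2 * ((j : ℝ) + 1) ≤ j)
    (hs : ∀ u, u + 2 ≤ j → s u ^ 2 * ((u : ℝ) + 2) ≤ 1) (hr : ∀ q, q < j → r q ^ 2 * ((j : ℝ) + 1 + q) ≤ j) {U : ℕ} (hU : U + 1 ≤ j)
    (m : ℕ) :
    2 * (∑ u ∈ range U, s u) * (h (m + 1) / h (m + j)) * (L 1 * h (m + 1) ^ 3 / 2) + 2 * ((j : ℝ) - 1 - U + ρ) * (L 1 * h (m + 1) ^ 3 / 2)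
      + 2 * (∑ q ∈ range j, r q) / j * (h (m + 1) / h (m + j)) ^ 3 * ((j : ℝ) * (L j * h (m + j) ^ 3 / 2))
      ≤ (h (m + 1) / h (m + j)) ^ 3 := by
  have hpos : ∀ n, 0 < h n := fun n => (hh n).1
  have hanti := (strictAnti_of_memFlow hb hlo hh hf).antitone
  have h1K : 1 < K := by omega
  have hjr : (0 : ℝ) < j := by exact_mod_cast (show 0 < j by omega)
  have hm1 := hpos (m + 1); have hmj := hpos (m + j)
  have hL1 := hL 1; have hLj := hL j
  -- the window: Σ_{q<j} [L_1h_{m+q+2} + L_jh_{m+j+1+q}] ≤ 1∕h_{m+j}²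
  have hwin : ∑ q ∈ range j, L 1 * h (m + q + 2) + ∑ q ∈ range j, L j * h (m + j + 1 + q) ≤ 1 / h (m + j) ^ 2 := by
    have e1 := invSq_sub_ge_all_reads hdom hh hf m j
    have e2 : ∑ q ∈ range j, (L 1 * h (m + q + 2) + L j * h (m + j + 1 + q)) ≤ ∑ q ∈ range j, ∑ i ∈ range K, L i * h (m + q + 1 + i) :=
      sum_le_sum fun q _ => by
        have := two_terms_le_reads hL hh (show 1 ≠ j by omega) h1K hjK (m + q + 1)
        rwa [show m + q + 1 + 1 = m + q + 2 by ring, show m + q + 1 + j = m + j + 1 + q by ring] at this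
    have e3 : 0 < 1 / h m ^ 2 := by have := hpos m; positivity
    rw [← sum_add_distrib]
    linarith
  -- the young reads: split range j = range U ∪ Ico U (j−1) ∪ {j−1}
  have hρj : ρ * h (m + j) ≤ h (m + j + 1) := ray_le hmono hb hlo hh hf m (j := j) (by omega) 1 (by push_cast; linarith)
  have hY : L 1 * (h (m + 1) * ∑ u ∈ range U, s u) + L 1 * h (m + j) * ((j : ℝ) - 1 - U) + L 1 * (ρ * h (m + j))
      ≤ ∑ q ∈ range j, L 1 * h (m + q + 2) := by
    obtain ⟨j', rfl⟩ : ∃ j', j = j' + 1 := ⟨j - 1, by omega⟩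
    have hUj' : U ≤ j' := by omega
    rw [sum_range_succ, show m + j' + 2 = m + (j' + 1) + 1 by ring, ← sum_range_add_sum_Ico _ hUj']
    -- the first U under the ray from the pin
    have hA : L 1 * (h (m + 1) * ∑ u ∈ range U, s u) ≤ ∑ q ∈ range U, L 1 * h (m + q + 2) := by
      rw [mul_sum, mul_sum]
      refine sum_le_sum fun u hu => mul_le_mul_of_nonneg_left ?_ hL1
      have hu2 : u + 2 ≤ j' + 1 := by have := mem_range.mp hu; omega
      have := ray_le hmono hb hlo hh hf m (j := 1) le_rfl (u + 1) (r := s u) (by push_cast; have := hs u hu2; linarith)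
      rw [show m + 1 + (u + 1) = m + u + 2 by ring] at this
      linarith
    -- the next j' − U at the level h_{m+j}
    have hB : L 1 * h (m + (j' + 1)) * (((j' : ℕ) + 1 : ℝ) - 1 - U) ≤ ∑ q ∈ Ico U j', L 1 * h (m + q + 2) := by
      have h1 : ∑ q ∈ Ico U j', L 1 * h (m + (j' + 1)) ≤ ∑ q ∈ Ico U j', L 1 * h (m + q + 2) :=
        sum_le_sum fun q hq => mul_le_mul_of_nonneg_left (hanti (by have := (mem_Ico.mp hq).2; omega)) hL1
      rw [sum_const, Nat.card_Ico, nsmul_eq_mul, Nat.cast_sub hUj'] at h1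
      linarith
    have hC := mul_le_mul_of_nonneg_left hρj hL1
    push_cast at hB ⊢
    linarith
  -- the middle's own window, term by term
  have hM : L j * (h (m + j) * ∑ q ∈ range j, r q) ≤ ∑ q ∈ range j, L j * h (m + j + 1 + q) := by
    rw [mul_sum, mul_sum]
    refine sum_le_sum fun q hq => mul_le_mul_of_nonneg_left ?_ hLj
    have := ray_le hmono hb hlo hh hf m (j := j) (by omega) (q + 1) (r := r q) (by push_cast; have := hr q (mem_range.mp hq); linarith)
    rw [show m + j + (q + 1) = m + j + 1 + q by ring] at this
    linarith
  -- assemble and multiply by h_{m+j}²·σ³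
  have hsum : L 1 * (h (m + 1) * ∑ u ∈ range U, s u) + L 1 * h (m + j) * ((j : ℝ) - 1 - U) + L 1 * (ρ * h (m + j))
      + L j * (h (m + j) * ∑ q ∈ range j, r q) ≤ 1 / h (m + j) ^ 2 := by linarith
  have hσpos : 0 < h (m + 1) / h (m + j) := div_pos hm1 hmj
  have key := mul_le_mul_of_nonneg_left hsum (le_of_lt (mul_pos (pow_pos hmj 2) (pow_pos hσpos 3)))
  have e1 : h (m + j) ^ 2 * (h (m + 1) / h (m + j)) ^ 3 * (1 / h (m + j) ^ 2) = (h (m + 1) / h (m + j)) ^ 3 := by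
    field_simp
  have e2 : h (m + j) ^ 2 * (h (m + 1) / h (m + j)) ^ 3 * (L 1 * (h (m + 1) * ∑ u ∈ range U, s u) + L 1 * h (m + j) * ((j : ℝ) - 1 - U)
        + L 1 * (ρ * h (m + j)) + L j * (h (m + j) * ∑ q ∈ range j, r q))
      = 2 * (∑ u ∈ range U, s u) * (h (m + 1) / h (m + j)) * (L 1 * h (m + 1) ^ 3 / 2) + 2 * ((j : ℝ) - 1 - U + ρ) * (L 1 * h (m + 1) ^ 3 / 2)
        + 2 * (∑ q ∈ range j, r q) / j * (h (m + 1) / h (m + j)) ^ 3 * ((j : ℝ) * (L j * h (m + j) ^ 3 / 2)) := by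
    field_simp
    ring
  rw [e1, e2] at key
  exact key

/-! ## §2 The young pair against the old read, refined letters -/
set_option maxHeartbeats 400000 in
/-- **THE CENSUS THREE AGES FROM THE REFINED YOUNG-PAIR POLYTOPE (parametric).**  As (E94b) `flow_nonneg_three_ages_young_pair_moment`, with the window
letter replaced by the family of `window_letter_refined` over all `U ≤ k₂−1` (young ray constants `s`, middle ray constants `r`): IF every point of the
refined polytope satisfies `(1−so)(x+y) + κ(x + (k₂+1)y∕2) ≤ 1 − so`, THEN `0 ≤ ε ≤ e` at every pin, every horizon, every damping of the self-consistent
class. [folklore] -/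
theorem flow_nonneg_three_ages_young_pair_moment_refined (hmono : ∀ u v : ℕ → ℝ, SeqBox γ u → SeqBox γ v → (∀ j, u j ≤ v j) → B u ≤ B v)
    (hL : ∀ k, 0 ≤ L k) (hb : 0 < b) (hlo : ∀ u, SeqBox γ u → b ≤ B u) (hdom : ∀ u, SeqBox γ u → ∑ k ∈ range K, L k * u k ≤ B u)
    (hh : SeqBox γ h) (hf : MemFlow B gIR h) (hg : ∀ t, 0 < g t ∧ g t ≤ 1)
    (hgF : ∀ t, 1 ≤ g t * (1 + ∑ k ∈ range K, L k * h (t + k) ^ 3 / 2))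
    {k₂ k₃ : ℕ} (hk2 : 2 ≤ k₂) (hk23 : k₂ < k₃) (hk3K : k₃ < K) (hL3 : ∀ j, j < K → j ≠ 1 → j ≠ k₂ → j ≠ k₃ → L j = 0)
    {ρ so κ : ℝ} {s r : ℕ → ℝ} (hρ : ρ ^ 2 * ((k₂ : ℝ) + 1) ≤ k₂)
    (hs : ∀ u, u + 2 ≤ k₂ → s u ^ 2 * ((u : ℝ) + 2) ≤ 1) (hr : ∀ q, q < k₂ → r q ^ 2 * ((k₂ : ℝ) + 1 + q) ≤ k₂)
    (hso0 : 0 < so) (hso1 : so < 1) (hso : 3 * (k₃ : ℝ) + 1 ≤ 8 * k₃ * so ^ 2) (hκ : 4 * so ≤ κ * k₃)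
    (hcond : ∀ σ x y : ℝ, 1 ≤ σ → σ ^ 2 ≤ k₂ → 0 ≤ x → 0 ≤ y →
      (141421 : ℝ) / 100000 * x + 2 * ρ / k₂ * σ ^ 2 * y ≤ 1 →
      (∀ U : ℕ, U + 1 ≤ k₂ → 2 * (∑ u ∈ range U, s u) * σ * x + 2 * ((k₂ : ℝ) - 1 - U + ρ) * x
        + 2 * (∑ q ∈ range k₂, r q) / k₂ * σ ^ 3 * y ≤ σ ^ 3) →
      (1 - so) * (x + y) + κ * (x + ((k₂ : ℝ) + 1) / 2 * y) ≤ 1 - so)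
    {N : ℕ} {KL : ℕ → ℕ → ℕ → ℝ}
    (hKL : ∀ k n l, KL k n l = if 0 < k ∧ k < K ∧ l < k then L k * h (n + k) ^ 3 / 2 * ∏ t ∈ Ico (n + 1 + l) (n + k + 1), g t else 0)
    {KA : ℕ → ℕ → ℕ → ℝ} {RA : ℕ → (ℕ → ℝ) → ℕ → ℝ}
    (hRA : ∀ i v m, RA i v m = ∑ l ∈ range K, KA i m l * v (m + 1 + l))
    (hKA : ∀ i m l, KA i m l = KL i m l + KA (i + 1) m l) (hKAtop : ∀ m l, KA K m l = 0)
    {e ε : ℕ → ℝ} (he0 : ∀ m, 0 ≤ e m) (hea : ∀ m, e (m + 1) ≤ e m)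
    (hεt : ∀ m, N < m → ε m = 0) (hεrec : ∀ m, ε m = e m - RA 1 ε m) : ∀ m, 0 ≤ ε m ∧ ε m ≤ e m := by
  have hpos : ∀ n, 0 < h n := fun n => (hh n).1
  have hK : 1 ≤ K := by omega
  have h1K : 1 < K := by omega
  have hk2K : k₂ < K := by omega
  have hj : 0 < k₂ := by omega
  have hk : 0 < k₃ := by omega
  have hL0 : L 0 = 0 := hL3 0 (by omega) (by omega) (by omega) (by omega)
  have hjr : (2 : ℝ) ≤ k₂ := by exact_mod_cast hk2
  have hkr : (0 : ℝ) < k₃ := by exact_mod_cast hk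
  have hκ0 : 0 ≤ κ := by
    by_contra hneg
    have : κ * k₃ < 0 := mul_neg_of_neg_of_pos (not_le.mp hneg) hkr
    linarith
  have hea' : ∀ p q, p ≤ q → e q ≤ e p := by
    intro p q hpq
    induction q, hpq using Nat.le_induction with
    | base => exact le_rfl
    | succ q _ ih => exact (hea q).trans ih
  -- the aggregate row is the young pair's rows plus the old row
  have hKA1 : ∀ m l, KA 1 m l = (KL 1 m l + KL k₂ m l) + KL k₃ m l := by
    intro m l
    have h1 : KA 1 m l = ∑ k' ∈ Ico 1 (K - 1 + 1), KL k' m l :=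
      aggregate_eq_sum (n := K - 1) hKA (fun m l => by rw [Nat.sub_add_cancel hK]; exact hKAtop m l) (show 1 ≤ K - 1 + 1 by omega) m l
    rw [h1, Nat.sub_add_cancel hK]
    have hsub : ({1, k₂, k₃} : Finset ℕ) ⊆ Ico 1 K := by
      intro x hx
      simp only [mem_insert, mem_singleton] at hx
      rw [mem_Ico]; rcases hx with rfl | rfl | rfl <;> omega
    rw [← sum_subset hsub (fun x hx hxn => by
      simp only [mem_insert, mem_singleton, not_or] at hxn
      rw [hKL]
      split_ifs
      · rw [hL3 x (mem_Ico.mp hx).2 hxn.1 hxn.2.1 hxn.2.2]; simp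
      · rfl), sum_insert (by simp only [mem_insert, mem_singleton]; omega), sum_pair (by omega)]
    ring
  have hrec2 : ∀ p, ε p = e p - ∑ l ∈ range K, (KL 1 p l + KL k₂ p l) * ε (p + 1 + l) - ∑ l ∈ range K, KL k₃ p l * ε (p + 1 + l) := by
    intro p
    rw [hεrec p, hRA]
    have : ∑ l ∈ range K, KA 1 p l * ε (p + 1 + l)
        = ∑ l ∈ range K, (KL 1 p l + KL k₂ p l) * ε (p + 1 + l) + ∑ l ∈ range K, KL k₃ p l * ε (p + 1 + l) := by
      rw [← sum_add_distrib]; exact sum_congr rfl fun l _ => by rw [hKA1]; ring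
    rw [this]; ring
  refine renewal_bounds_of_step he0 hεt fun m IH => ?_
  have hreadY0 : ∀ p, m ≤ p → 0 ≤ ∑ l ∈ range K, (KL 1 p l + KL k₂ p l) * ε (p + 1 + l) := fun p hp =>
    sum_nonneg fun l _ => mul_nonneg (add_nonneg (kernel_entry_le hL hh hg hKL 1 p l).1 (kernel_entry_le hL hh hg hKL k₂ p l).1)
      (IH _ (by omega)).1
  have hreadO0 : ∀ p, m ≤ p → 0 ≤ ∑ l ∈ range K, KL k₃ p l * ε (p + 1 + l) := fun p hp =>
    sum_nonneg fun l _ => mul_nonneg (kernel_entry_le hL hh hg hKL k₃ p l).1 (IH _ (by omega)).1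
  -- the letters at the pin
  set c1 := L 1 * h (m + 1) ^ 3 / 2 with hc1_def
  set c2 := L k₂ * h (m + k₂) ^ 3 / 2 with hc2_def
  set c3 := L k₃ * h (m + k₃) ^ 3 / 2 with hc3_def
  have hc10 : 0 ≤ c1 := by have := hL 1; have := hpos (m + 1); positivity
  have hc20 : 0 ≤ c2 := by have := hL k₂; have := hpos (m + k₂); positivity
  have hc30 : 0 ≤ c3 := by have := hL k₃; have := hpos (m + k₃); positivity
  have hx3 : (k₃ : ℝ) * c3 ≤ so := load_le_of_sq hmono hL hb hlo hdom hh hf (by omega) hk3K hso0 hso m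
  obtain ⟨hσ1, hσ2, hP1, -⟩ := young_pair_letters hmono hL hb hlo hdom hh hf hk2 hk2K hρ (ζ := 0) (by rw [zero_pow two_ne_zero, zero_mul]; positivity) m
  have hP2 := fun (U : ℕ) (hU : U + 1 ≤ k₂) => window_letter_refined hmono hL hb hlo hdom hh hf hk2 hk2K hρ hs hr hU m
  set σ := h (m + 1) / h (m + k₂) with hσ_def
  have hfin := hcond σ c1 ((k₂ : ℝ) * c2) hσ1 hσ2 hc10 (by positivity) hP1 hP2
  have hem := he0 m
  -- STEP 1: the old residual e − O ≥ (1 − x₃)e ≥ (1 − so)e ≥ 0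
  have hOle : ∑ l ∈ range K, KL k₃ m l * ε (m + 1 + l) ≤ (k₃ : ℝ) * c3 * e m := by
    calc ∑ l ∈ range K, KL k₃ m l * ε (m + 1 + l) ≤ ∑ l ∈ range K, KL k₃ m l * e m :=
          sum_le_sum fun l _ => mul_le_mul_of_nonneg_left
            (((IH _ (by omega)).2).trans (hea' m (m + 1 + l) (by omega))) (kernel_entry_le hL hh hg hKL k₃ m l).1
      _ = (∑ l ∈ range K, KL k₃ m l) * e m := by rw [sum_mul]
      _ ≤ (k₃ : ℝ) * c3 * e m := mul_le_mul_of_nonneg_right (row_mass_le hL hh hg hKL hk3K m) hem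
  have hres1 : (1 - so) * e m ≤ e m - ∑ l ∈ range K, KL k₃ m l * ε (m + 1 + l) := by
    have := mul_le_mul_of_nonneg_right hx3 hem
    linarith only [hOle, this]
  have hres1' : 0 ≤ e m - ∑ l ∈ range K, KL k₃ m l * ε (m + 1 + l) := le_trans (mul_nonneg (by linarith) hem) hres1
  -- STEP 2: the young pair against the old read, first moment x + (k₂+1)y∕2, variation 4c₃ per lag
  have hWy : ∑ l ∈ range K, (KL 1 m l + KL k₂ m l) ≤ c1 + (k₂ : ℝ) * c2 := by
    rw [sum_add_distrib]
    have h1 : ∑ l ∈ range K, KL 1 m l ≤ c1 := by have := row_mass_le hL hh hg hKL h1K m; simpa using this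
    have h2 : ∑ l ∈ range K, KL k₂ m l ≤ (k₂ : ℝ) * c2 := row_mass_le hL hh hg hKL hk2K m
    linarith
  have hMy : ∑ l ∈ range K, (KL 1 m l + KL k₂ m l) * ((l : ℝ) + 1) ≤ c1 + ((k₂ : ℝ) + 1) / 2 * ((k₂ : ℝ) * c2) := by
    simp_rw [add_mul]
    rw [sum_add_distrib]
    have h1 := row_moment_le hL hh hg hKL h1K m
    have h2 := row_moment_le hL hh hg hKL hk2K m
    rw [← hc1_def] at h1
    rw [← hc2_def] at h2
    norm_num at h1
    have e : c2 * ((k₂ : ℝ) * ((k₂ : ℝ) + 1) / 2) = ((k₂ : ℝ) + 1) / 2 * ((k₂ : ℝ) * c2) := by ring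
    linarith
  have hstep := residual_step_moment (i := k₂) (Kw := K) (m := m) (sy := c1 + (k₂ : ℝ) * c2) (V := 4 * c3)
    (M₁ := c1 + ((k₂ : ℝ) + 1) / 2 * ((k₂ : ℝ) * c2))
    (wy := fun l => KL 1 m l + KL k₂ m l) (O := fun p => ∑ l ∈ range K, KL k₃ p l * ε (p + 1 + l)) (e := e) (ε := ε)
    (fun l => add_nonneg (kernel_entry_le hL hh hg hKL 1 m l).1 (kernel_entry_le hL hh hg hKL k₂ m l).1)
    (fun l hl => by rw [hKL, if_neg (by omega), hKL, if_neg (by omega), add_zero])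
    hWy hMy (by positivity) he0 hea
    (fun q hq => by
      have := hrec2 q
      have h1 := hreadY0 q hq.le
      linarith only [this, h1])
    hres1'
    (fun d hd1 hdj => by
      have hdk : d ≤ k₃ := by omega
      have hv' := old_read_variation hmono hL hb hlo hdom hh hf hL0 hg hgF hKL hk hk3K hd1 hdk he0 hea IH
      rw [← hc3_def] at hv'
      linarith only [hv'])
  -- assemble
  have hεm := hrec2 m
  refine ⟨?_, ?_⟩
  · have hsy1 : 0 ≤ 1 - (c1 + (k₂ : ℝ) * c2) := by
      have : 0 ≤ κ * (c1 + ((k₂ : ℝ) + 1) / 2 * ((k₂ : ℝ) * c2)) := by positivity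
      nlinarith [hfin, this]
    have h1 := mul_le_mul_of_nonneg_left hres1 hsy1
    -- M₁·4c₃ ≤ κ·M₁ (4c₃ ≤ 4so∕k₃ ≤ κ)
    have hc3' : 4 * c3 ≤ κ := by
      have : 4 * ((k₃ : ℝ) * c3) ≤ κ * k₃ := by linarith
      by_contra hneg
      have : κ * k₃ < 4 * c3 * k₃ := mul_lt_mul_of_pos_right (not_le.mp hneg) hkr
      linarith
    have h2 : (c1 + ((k₂ : ℝ) + 1) / 2 * ((k₂ : ℝ) * c2)) * (4 * c3) * e m ≤ κ * (c1 + ((k₂ : ℝ) + 1) / 2 * ((k₂ : ℝ) * c2)) * e m := by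
      have := mul_le_mul_of_nonneg_left hc3' (show 0 ≤ c1 + ((k₂ : ℝ) + 1) / 2 * ((k₂ : ℝ) * c2) by positivity)
      nlinarith [this, hem]
    have h3 : 0 ≤ ((1 - so) * (1 - (c1 + (k₂ : ℝ) * c2)) - κ * (c1 + ((k₂ : ℝ) + 1) / 2 * ((k₂ : ℝ) * c2))) * e m :=
      mul_nonneg (by linarith) hem
    rw [hεm]
    linarith [hstep, h1, h2, h3]
  · rw [hεm]
    linarith only [hreadY0 m le_rfl, hreadO0 m le_rfl]


end Summit.QuantumFields.BalabanUV.Beta.EriceRemainderEnclosureHistoryAutonomyComparisonAgeCompositionYoungPairMomentRefined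

end
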